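import Literature.MathematicalPhysics.QuantumFieldTheory.OSReconstructionNoE1Proofs
import HarnessLib

/-!
# A vector orthogonal to its own Euclidean time translate is null (OS reconstruction without E1)

For the E1-free Osterwalder–Schrader reconstruction `h : OSReconstructionNoE1 S` of a labelled
Schwinger family (`OSReconstructionNoE1.lean`: physical Hilbert space `h.Hilbert`, contraction
semigroup `h.transfer t = e^{-tH}`, field vectors `h.fieldVec`), the time correlation of a vector with
itself is the Laplace transform of its (joint) spectral measure,
`⟪ψ, e^{-tH} ψ⟫ = ∫ e^{-t p₀} dμ_ψ(p)` (`IsJointSpectralMeasure.inner_transfer`, existence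
`exists_isJointSpectralMeasure_holds`), with total mass `‖ψ‖²`. Since the integrand is STRICTLY
positive, ONE zero of this function forces `μ_ψ = 0`, i.e. `ψ = 0`:

* `OSReconstructionNoE1.eq_zero_of_inner_transfer_eq_zero` — `⟪ψ, e^{-tH} ψ⟫ = 0` for some `t ≥ 0`
  implies `ψ = 0`;
* `OSReconstructionNoE1.inner_transfer_self_re_pos` — for `ψ ≠ 0`, `Re ⟪ψ, e^{-tH} ψ⟫ > 0` for ALL
  `t ≥ 0` (a Laplace transform of a non-zero positive measure never vanishes);
* `OSReconstructionNoE1.fieldVec_eq_zero_of_schwinger_eq_zero` and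
  `OSReconstructionNoE1.schwinger_eq_zero_of_self_time_translate` — the Schwinger-function form: if
  `𝔖_{2n}^{rev k ++ k}(ΘF* ⊗ F_t) = 0` for ONE `t ≥ 0` (time-ordered `F`), then the field vector `Ψ_F`
  vanishes and hence `𝔖_{n+m}^{rev k ++ k'}(ΘF* ⊗ G) = 0` for every time-ordered `G` ("Reeh–Schlieder
  along the time axis", the elementary half: no analyticity is needed, only positivity of the energy).

This is the engine of the "full support" step in the Euclidean proof of Källén–Lehmann positivity
(`KallenLehmannPositivity`, crux `ContinuumLegGivenGap` line `duality-selection-nlo-skewness`,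
`Lines/duality-selection-KL-roadmap.md`): a reflection-positive translated autocorrelation bump whose
pairing with the two-point function vanishes at one separation vanishes at all separations.

References: K. Osterwalder, R. Schrader, CMP 31 (1973) §4.1; J. Glimm, A. Jaffe, *Quantum Physics*
(2nd ed.), §6.1 Thm. 6.1.3; M. Reed, B. Simon I, Thm. VIII.12. All statements here are proved.
-/

noncomputable section

open MeasureTheory
open scoped InnerProductSpace SchwartzMap ComplexOrder
open Literature.MathematicalPhysics.AQFT Literature.MathematicalPhysics.QuantumLattice
open Literature.MathematicalPhysics.QuantumLattice.SchwingerFamily (timeVec)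

namespace Literature.MathematicalPhysics.QuantumFieldTheory

universe u

variable {ι : Type u} {d : ℕ} [NeZero d] {S : LabelledSchwingerFamily ι (EuclideanSpace ℝ (Fin d))}

namespace OSReconstructionNoE1

variable (h : OSReconstructionNoE1 S)

/-- The Laplace integrand `e^{-t p₀}` of a joint spectral measure is integrable (`μ` is finite and
carried by `{p₀ ≥ 0}`, where the integrand is bounded by `1`). [folklore] -/
theorem IsJointSpectralMeasure.integrable_exp_neg {ψ : h.Hilbert} {μ : Measure (EuclideanSpace ℝ (Fin d))}
    (hμ : h.IsJointSpectralMeasure ψ μ) {t : ℝ} (ht : 0 ≤ t) :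
    Integrable (fun p : EuclideanSpace ℝ (Fin d) => Real.exp (-(t * p 0))) μ := by
  haveI := hμ.isFiniteMeasure
  have hmeas : AEStronglyMeasurable (fun p : EuclideanSpace ℝ (Fin d) => Real.exp (-(t * p 0))) μ := by
    fun_prop
  refine Integrable.of_bound (C := 1) hmeas ?_
  have hae : ∀ᵐ p ∂μ, ¬ p 0 < 0 := by
    rw [ae_iff]
    simpa using hμ.energy_nonneg
  filter_upwards [hae] with p hp
  rw [Real.norm_eq_abs, abs_of_pos (Real.exp_pos _), Real.exp_le_one_iff, neg_nonpos]
  exact mul_nonneg ht (not_lt.1 hp)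

/-- The time correlation of a vector with itself is the REAL Laplace transform of its joint spectral
measure: `⟪ψ, e^{-tH} ψ⟫ = ∫ e^{-t p₀} dμ_ψ` as a real integral cast to `ℂ`. [folklore] -/
theorem IsJointSpectralMeasure.inner_transfer_eq_ofReal_integral {ψ : h.Hilbert}
    {μ : Measure (EuclideanSpace ℝ (Fin d))} (hμ : h.IsJointSpectralMeasure ψ μ) {t : ℝ} (ht : 0 ≤ t) :
    ⟪ψ, h.transfer t ψ⟫_ℂ = ((∫ p, Real.exp (-(t * p 0)) ∂μ : ℝ) : ℂ) := by
  rw [hμ.inner_transfer h ht, ← integral_complex_ofReal]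
  refine integral_congr_ae (ae_of_all _ fun p => ?_)
  exact (Complex.ofReal_exp _).symm

/-- **A vector orthogonal to its own Euclidean time translate is null**: if `⟪ψ, e^{-tH} ψ⟫ = 0` for
some `t ≥ 0` then `ψ = 0` — the Laplace transform `∫ e^{-tp₀} dμ_ψ` of the (finite, positive) joint
spectral measure has a strictly positive integrand, so it vanishes only if `μ_ψ = 0`, whose total mass
is `‖ψ‖²`. (Osterwalder–Schrader 1973 §4.1 / Glimm–Jaffe Thm. 6.1.3 for the semigroup; Reed–Simon I
Thm. VIII.12 for the spectral measure.) [folklore] -/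
theorem eq_zero_of_inner_transfer_eq_zero {ψ : h.Hilbert} {t : ℝ} (ht : 0 ≤ t)
    (h0 : ⟪ψ, h.transfer t ψ⟫_ℂ = 0) : ψ = 0 := by
  obtain ⟨μ, hμ⟩ := exists_isJointSpectralMeasure_holds h ψ
  haveI := hμ.isFiniteMeasure
  have hint : ∫ p, Real.exp (-(t * p 0)) ∂μ = 0 := by
    have h1 := hμ.inner_transfer_eq_ofReal_integral h ht
    rw [h0] at h1
    exact_mod_cast h1.symm
  rw [integral_eq_zero_iff_of_nonneg (fun p => (Real.exp_pos _).le) (hμ.integrable_exp_neg h ht)] at hint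
  -- the integrand never vanishes, so `μ = 0`
  have huniv : μ Set.univ = 0 := by
    have h2 := ae_iff.1 hint
    have hset : {p : EuclideanSpace ℝ (Fin d) |
        ¬ (fun p : EuclideanSpace ℝ (Fin d) => Real.exp (-(t * p 0))) p = (0 : EuclideanSpace ℝ (Fin d) → ℝ) p} =
        Set.univ := by
      ext p
      simp [(Real.exp_pos _).ne']
    rwa [hset] at h2
  have hμ0 : μ = 0 := Measure.measure_univ_eq_zero.1 huniv
  have hnorm : ‖ψ‖ ^ 2 = 0 := by
    rw [← hμ.measureReal_univ, hμ0]
    simp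
  exact norm_eq_zero.1 (pow_eq_zero_iff two_ne_zero |>.1 hnorm)

/-- **The time correlation of a non-zero vector never vanishes**: for `ψ ≠ 0` and every `t ≥ 0`,
`Re ⟪ψ, e^{-tH} ψ⟫ > 0` (it is `‖e^{-tH/2} ψ‖² ≥ 0`, and `= 0` would force `ψ = 0`). [folklore] -/
theorem inner_transfer_self_re_pos {ψ : h.Hilbert} (hψ : ψ ≠ 0) {t : ℝ} (ht : 0 ≤ t) :
    0 < (⟪ψ, h.transfer t ψ⟫_ℂ).re := by
  have heq := h.inner_transfer_self_eq ht ψ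
  have hre : (⟪ψ, h.transfer t ψ⟫_ℂ).re = ‖h.transfer (t / 2) ψ‖ ^ 2 := by
    rw [heq, Complex.ofReal_re]
  rw [hre]
  rcases (sq_nonneg ‖h.transfer (t / 2) ψ‖).lt_or_eq with hlt | heq0
  · exact hlt
  · exfalso
    refine hψ (h.eq_zero_of_inner_transfer_eq_zero ht ?_)
    rw [heq, ← heq0, Complex.ofReal_zero]

/-- **Schwinger-function form, I**: if the OS pairing of a time-ordered `F` with its own Euclidean
time translate vanishes at ONE `t ≥ 0`, `𝔖_{n+n}^{rev k ++ k}(ΘF* ⊗ F_t) = 0`, then the field vector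
`Ψ_F^{k}` is zero. [folklore] -/
theorem fieldVec_eq_zero_of_schwinger_eq_zero {n : ℕ} (k : Fin n → ι)
    {F : 𝓢((Fin n → EuclideanSpace ℝ (Fin d)), ℂ)} (hF : IsTimeOrdered F) {t : ℝ} (ht : 0 ≤ t)
    {H : 𝓢((Fin (n + n) → EuclideanSpace ℝ (Fin d)), ℂ)}
    (hH : IsAppendTensorOf H (osAdjoint F) (translateMulti (timeVec t) F))
    (h0 : S (n + n) (Fin.append (k ∘ Fin.rev) k) H = 0) :
    h.fieldVec n k F hF = 0 := by
  refine h.eq_zero_of_inner_transfer_eq_zero ht ?_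
  rw [h.transfer_fieldVec ht n k F hF, h.inner_fieldVec_fieldVec k k hF _ hH, h0]

include h in
/-- **Schwinger-function form, II ("Reeh–Schlieder along the time axis", elementary half)**: if
`𝔖_{n+n}^{rev k ++ k}(ΘF* ⊗ F_t) = 0` for one `t ≥ 0`, then `𝔖_{n+m}^{rev k ++ k'}(ΘF* ⊗ G) = 0` for
EVERY time-ordered `G` and label string `k'`. [folklore] -/
theorem schwinger_eq_zero_of_self_time_translate {n m : ℕ} (k : Fin n → ι) (k' : Fin m → ι)
    {F : 𝓢((Fin n → EuclideanSpace ℝ (Fin d)), ℂ)} {G : 𝓢((Fin m → EuclideanSpace ℝ (Fin d)), ℂ)}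
    (hF : IsTimeOrdered F) (hG : IsTimeOrdered G) {t : ℝ} (ht : 0 ≤ t)
    {H : 𝓢((Fin (n + n) → EuclideanSpace ℝ (Fin d)), ℂ)}
    (hH : IsAppendTensorOf H (osAdjoint F) (translateMulti (timeVec t) F))
    (h0 : S (n + n) (Fin.append (k ∘ Fin.rev) k) H = 0)
    {H' : 𝓢((Fin (n + m) → EuclideanSpace ℝ (Fin d)), ℂ)} (hH' : IsAppendTensorOf H' (osAdjoint F) G) :
    S (n + m) (Fin.append (k ∘ Fin.rev) k') H' = 0 := by
  rw [← h.inner_fieldVec_fieldVec k k' hF hG hH', h.fieldVec_eq_zero_of_schwinger_eq_zero k hF ht hH h0,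
    inner_zero_left]

end OSReconstructionNoE1

end Literature.MathematicalPhysics.QuantumFieldTheory

end
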